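import Literature.NumberTheory.GaloisRepresentations.HerbrandTateBridge
import Literature.NumberTheory.GaloisRepresentations.SemiLocalArchimedeanHilbert90
import HarnessLib

/-!
# `#H²(Stab(w₀), E_{w₀}ˣ) = #Ĥ⁰(Stab(w₀), E_{w₀}ˣ) = #Stab(w₀) ∈ {1, 2}` at every infinite place
# (Tate, C–F VII §7.3 Cor. 7.4 (b) at the archimedean places; Childress Prop. 5.7 (i)–(ii) in Tate-cohomology form)

Topic `NumberTheory/GaloisRepresentations`; namespace `Literature.NumberTheory.GaloisRepresentations.ArchHerbrand`,
continuing `SemiLocalArchimedeanShapiro.lean` / `SemiLocalArchimedeanHilbert90.lean` (the `Stab(w₀)`-module `E_{w₀}ˣ`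
= `archLocalUnitsRep w₀`, Shapiro `groupCohomologyArchUnitsRepIso`, `H¹ = 0`) and `HerbrandTateBridge.lean`
(`Herbrand.h0 σ A ⊥ = #Ĥ⁰ = #H²` for cyclic groups), fed with the tree's archimedean index computation
`ArchHerbrand.h0_infUnits_eq_card_stabilizer` (Childress Prop. 5.7 (i)–(ii): `#Ĥ⁰(G, ∏_{w∣v} E_wˣ) = #G_{w₀}` for
`Gal(E/F) = ⟨σ⟩` cyclic).  Theorems only; NO named fact, no `sorry`, no instance, no notation; fields in `Type`.

Mathematics.  Tate, Cor. 7.4 (b) [held copy `book:editornd-algebraic-number-theory` p0217]: "`H²(G, J_L) ≃ ⨿_v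
((1/n_v) ℤ/ℤ)`, where `n_v = [L^v : K_v]`" — at an infinite place `v` the local degree `n_v = #Stab(w₀) ∈ {1, 2}` and
the summand is `H²(Stab(w₀), E_{w₀}ˣ)`, of order `n_v` (for `w₀` complex over `v` real: `H²({1,c}, ℂˣ) = ℝˣ/N ℂˣ =
ℝˣ/ℝ_{>0}`).  Proof here: first for `Gal(E/F)` cyclic (the bridge turns `h0_infUnits_eq_card_stabilizer` into
`#H²(G, ∏_{w∣v} E_wˣ) = #Stab(w₀)`, then Shapiro), then in general by passing to the base field `K = E^{Stab(w₀)}` over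
which `E` is cyclic with group `Stab(w₀)` (Mathlib `IntermediateField.fixingSubgroupEquiv`; the `Stab(w₀)`-module
`E_{w₀}ˣ` does not depend on the base field, `groupCohomology.mapIso` along `Stab_F(w₀) ≃* Stab_K(w₀)`).

## What is formalised (`F E : Type` fields, `E/F` finite Galois, `w₀ : InfinitePlace E`, `v = w₀|_F`)

* `natCard_H2_archUnitsRep_of_cyclic` (`Gal(E/F) = ⟨σ⟩`: `#H²(G, ∏_{w∣v} E_wˣ) = #Stab(w₀)`),
  `natCard_H2_archLocalUnitsRep_of_cyclic`.
* **`natCard_H2_archLocalUnitsRep w₀ : Nat.card H²(Stab(w₀), E_{w₀}ˣ) = Nat.card Stab(w₀)`** (any finite Galois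
  `E/F`), **`natCard_H2_archUnitsRep v : Nat.card H²(Gal(E/F), ∏_{w∣v} E_wˣ) = Nat.card Stab(w₀)`**,
  `natCard_H2_archLocalUnitsRep_le_two`, `two_nsmul_eq_zero_H2_archLocalUnitsRep`-type consequences are left to users.

## References
* J. W. S. Cassels, A. Fröhlich (eds.), *Algebraic Number Theory* (1967), Ch. VII (Tate) §7.3 Cor. 7.4 (b).
  [CasselsFrohlichANT1967]
* N. Childress, *Class Field Theory* (2009), Ch. 4 §5 Prop. 5.7 (i)–(ii). [Childress2009]
* J.-P. Serre, *Local Fields*, GTM 67 (1979), Ch. VIII §4 Prop. 6 Corollary (period two). [SerreLocalFields1979]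
-/

noncomputable section

open NumberField NumberField.InfinitePlace CategoryTheory CategoryTheory.Limits groupCohomology
open Literature.NumberTheory.Automorphic

namespace Literature.NumberTheory.GaloisRepresentations

namespace ArchHerbrand

open Literature.Algebra.Homology

variable {F : Type} [Field F] {E : Type} [Field E] [Algebra F E]

/-! ## §1. Cyclic `Gal(E/F)` -/

/-- **`#H²(Gal(E/F), ∏_{w∣v} E_wˣ) = #Stab(w₀)` for `Gal(E/F) = ⟨σ⟩` cyclic** (`v = w₀|_F`): Childress Prop. 5.7
(i)–(ii) `h0 σ (infUnits E v) ⊥ = #Stab(w₀)` through the Herbrand–Tate bridge in degree two.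
[cite: Childress2009, Ch. 4 §5 Prop. 5.7 (i)–(ii)][cite: CasselsFrohlichANT1967, Ch. VII §7.3 Cor. 7.4 (b)] -/
theorem natCard_H2_archUnitsRep_of_cyclic [FiniteDimensional F E] [IsGalois F E] {σ : E ≃ₐ[F] E}
    (hσ : ∀ τ : E ≃ₐ[F] E, τ ∈ Subgroup.zpowers σ) (w₀ : InfinitePlace E) :
    Nat.card (groupCohomology (archUnitsRep (E := E) (w₀.comap (algebraMap F E))) 2) =
      Nat.card (MulAction.stabilizer (E ≃ₐ[F] E) w₀) := by
  rw [← h0_infUnits_eq_card_stabilizer hσ (rfl : IsOver E (w₀.comap (algebraMap F E)) w₀)]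
  exact (Herbrand.h0_bot_eq_natCard_groupCohomology_two (infUnits E (w₀.comap (algebraMap F E)))
    (fun τ _ hx => isStable_infUnits (w₀.comap (algebraMap F E)) τ hx) hσ).symm

/-- **`#H²(Stab(w₀), E_{w₀}ˣ) = #Stab(w₀)` for `Gal(E/F)` cyclic** (Shapiro `groupCohomologyArchUnitsRepIso`).
[cite: CasselsFrohlichANT1967, Ch. VII §7.3 Cor. 7.4 (b)] -/
theorem natCard_H2_archLocalUnitsRep_of_cyclic [FiniteDimensional F E] [IsGalois F E] {σ : E ≃ₐ[F] E}
    (hσ : ∀ τ : E ≃ₐ[F] E, τ ∈ Subgroup.zpowers σ) (w₀ : InfinitePlace E) :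
    Nat.card (groupCohomology (archLocalUnitsRep (F := F) w₀) 2) = Nat.card (MulAction.stabilizer (E ≃ₐ[F] E) w₀) := by
  rw [← natCard_H2_archUnitsRep_of_cyclic hσ w₀]
  exact (Nat.card_congr (groupCohomologyArchUnitsRepIso w₀ 2).toLinearEquiv.toEquiv).symm

/-! ## §2. Any finite Galois `E/F`: pass to the base `E^{Stab(w₀)}` -/

/-- Over the fixed field `K = E^{Stab(w₀)}` the Galois group `Gal(E/K) ≃ Stab(w₀)` fixes `w₀`: its stabiliser of
`w₀` is everything. [cite: CasselsFrohlichANT1967, Ch. VII §1.1] -/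
theorem stabilizer_fixedField_eq_top [FiniteDimensional F E] [IsGalois F E] (w₀ : InfinitePlace E) :
    MulAction.stabilizer (E ≃ₐ[IntermediateField.fixedField (MulAction.stabilizer (E ≃ₐ[F] E) w₀)] E) w₀ = ⊤ := by
  rw [eq_top_iff]
  intro τ _
  rw [MulAction.mem_stabilizer_iff]
  have hτ : τ.restrictScalars F ∈ (IntermediateField.fixedField (MulAction.stabilizer (E ≃ₐ[F] E) w₀)).fixingSubgroup :=
    ((IntermediateField.fixingSubgroupEquiv _).symm τ).2
  rw [IntermediateField.fixingSubgroup_fixedField] at hτ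
  exact hτ

/-- **`#H²(Stab(w₀), E_{w₀}ˣ) = #Stab(w₀)` for every finite Galois `E/F` and every infinite place `w₀` of `E`**
(the local degree `n_v ∈ {1,2}` of Tate's Cor. 7.4 (b) at an infinite place): pass to `K = E^{Stab(w₀)}`, over which
`E` is cyclic with group `Stab(w₀)` (Mathlib `fixingSubgroupEquiv`, `fixingSubgroup_fixedField`), apply §1, and
transport along `Stab_F(w₀) ≃* Stab_K(w₀)` (the module `E_{w₀}ˣ` and its action do not see the base field).
[cite: CasselsFrohlichANT1967, Ch. VII §7.3 Cor. 7.4 (b)] -/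
theorem natCard_H2_archLocalUnitsRep [FiniteDimensional F E] [IsGalois F E] (w₀ : InfinitePlace E) :
    Nat.card (groupCohomology (archLocalUnitsRep (F := F) w₀) 2) = Nat.card (MulAction.stabilizer (E ≃ₐ[F] E) w₀) := by
  set U := MulAction.stabilizer (E ≃ₐ[F] E) w₀ with hU
  let K : IntermediateField F E := IntermediateField.fixedField U
  have hK : K.fixingSubgroup = U := IntermediateField.fixingSubgroup_fixedField U
  let e : U ≃* (E ≃ₐ[K] E) := (MulEquiv.subgroupCongr hK.symm).trans (IntermediateField.fixingSubgroupEquiv K)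
  -- `Gal(E/K)` is cyclic (order `≤ 2`), generated by some `σ`
  haveI : IsCyclic U := by
    rcases InfinitePlace.nat_card_stabilizer_eq_one_or_two F w₀ with h | h
    · haveI : Subsingleton U := (Nat.card_eq_one_iff_unique.mp h).1
      infer_instance
    · haveI : Fact (Nat.Prime 2) := ⟨Nat.prime_two⟩
      exact isCyclic_of_prime_card h
  haveI : IsCyclic (E ≃ₐ[K] E) := isCyclic_of_surjective e.toMonoidHom e.surjective
  obtain ⟨σ, hσ⟩ := IsCyclic.exists_generator (α := E ≃ₐ[K] E)
  -- Stab_K(w₀) = ⊤ ≃ Stab_F(w₀), and the modules agree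
  have htop := stabilizer_fixedField_eq_top (F := F) w₀
  let e' : U ≃* MulAction.stabilizer (E ≃ₐ[K] E) w₀ :=
    e.trans ((MulEquiv.subgroupCongr htop).trans Subgroup.topEquiv).symm
  have iso : groupCohomology (archLocalUnitsRep (F := F) w₀) 2 ≅ groupCohomology (archLocalUnitsRep (F := K) w₀) 2 :=
    groupCohomology.mapIso e' (LinearEquiv.refl ℤ _) (fun _ => rfl) 2
  rw [Nat.card_congr iso.toLinearEquiv.toEquiv, natCard_H2_archLocalUnitsRep_of_cyclic (F := K) hσ w₀,
    ← Nat.card_congr e'.toEquiv]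

/-- **`#H²(Gal(E/F), ∏_{w∣v} E_wˣ) = #Stab(w₀)`** for every finite Galois `E/F`, `v = w₀|_F` an infinite place
(Shapiro + `natCard_H2_archLocalUnitsRep`). [cite: CasselsFrohlichANT1967, Ch. VII §7.3 Cor. 7.4 (b)] -/
theorem natCard_H2_archUnitsRep [FiniteDimensional F E] [IsGalois F E] (w₀ : InfinitePlace E) :
    Nat.card (groupCohomology (archUnitsRep (E := E) (w₀.comap (algebraMap F E))) 2) =
      Nat.card (MulAction.stabilizer (E ≃ₐ[F] E) w₀) := by
  rw [Nat.card_congr (groupCohomologyArchUnitsRepIso w₀ 2).toLinearEquiv.toEquiv]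
  exact natCard_H2_archLocalUnitsRep w₀

/-- `#H²(Stab(w₀), E_{w₀}ˣ) ∈ {1, 2}` (Mathlib `nat_card_stabilizer_eq_one_or_two`).
[cite: CasselsFrohlichANT1967, Ch. VII §7.3 Cor. 7.4 (b)] -/
theorem natCard_H2_archLocalUnitsRep_eq_one_or_two [FiniteDimensional F E] [IsGalois F E] (w₀ : InfinitePlace E) :
    Nat.card (groupCohomology (archLocalUnitsRep (F := F) w₀) 2) = 1 ∨
      Nat.card (groupCohomology (archLocalUnitsRep (F := F) w₀) 2) = 2 := by
  rw [natCard_H2_archLocalUnitsRep w₀]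
  exact InfinitePlace.nat_card_stabilizer_eq_one_or_two F w₀

/-- At an infinite place UNRAMIFIED in `E` the summand is trivial: `#H²(Stab(w₀), E_{w₀}ˣ) = 1`.
[cite: CasselsFrohlichANT1967, Ch. VII §7.3 Cor. 7.4 (b)] -/
theorem natCard_H2_archLocalUnitsRep_eq_one [FiniteDimensional F E] [IsGalois F E] (w₀ : InfinitePlace E)
    (hw : InfinitePlace.IsUnramified F w₀) : Nat.card (groupCohomology (archLocalUnitsRep (F := F) w₀) 2) = 1 := by
  rw [natCard_H2_archLocalUnitsRep w₀, hw.stabilizer_eq_bot, Subgroup.card_bot]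

/-- At an infinite place RAMIFIED in `E` (real under complex) the summand has order `2`:
`#H²(Stab(w₀), E_{w₀}ˣ) = 2` (`H²({1,c}, ℂˣ) = ℝˣ/ℝ_{>0}`). [cite: CasselsFrohlichANT1967, Ch. VII §7.3 Cor. 7.4 (b)] -/
theorem natCard_H2_archLocalUnitsRep_eq_two [FiniteDimensional F E] [IsGalois F E] (w₀ : InfinitePlace E)
    (hw : ¬ InfinitePlace.IsUnramified F w₀) : Nat.card (groupCohomology (archLocalUnitsRep (F := F) w₀) 2) = 2 := by
  rw [natCard_H2_archLocalUnitsRep w₀]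
  exact InfinitePlace.not_isUnramified_iff_card_stabilizer_eq_two.mp hw

end ArchHerbrand

end Literature.NumberTheory.GaloisRepresentations

end
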